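import Summits.BirchSwinnertonDyer.BirchSwinnertonDyer.Theorems.GenusKolyvaginAtTwoGenusPrimitiveSupplyAtTwoArchimedeanUnramifiedFrame
import Summits.BirchSwinnertonDyer.BirchSwinnertonDyer.Theorems.GenusKolyvaginAtTwoGenusPrimitiveSupplyAtTwoArchimedeanRowsHold
import Summits.BirchSwinnertonDyer.BirchSwinnertonDyer.Theorems.GenusKolyvaginAtTwoGenusPrimitiveSupplyAtTwoArchimedeanDescAdmissible
import Summits.BirchSwinnertonDyer.BirchSwinnertonDyer.Theorems.GenusKolyvaginAtTwoGenusPrimitiveSupplyAtTwoTwistDyadicUnramifiedSqrt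
import HarnessLib

/-!
# Route `GenusKolyvaginAtTwo`, crux #2 `GenusPrimitiveSupplyAtTwo` (stmt-BirchSwinnertonDyer-22136):
# the cell's T-A⁵ `F1Sign2.UnramifiedTwistSelmerShiftAtTwo` and T-A⁵′ `F1Sign2.MixedTwistSelmerLevelAtTwo` BY NAME, UNCONDITIONALLY
# (`d ≡ 5 (mod 8)`, `W` good at `2`: Mazur's norm theorem at the dyadic place)

Width seat `bsd-line-gk2-p5` g12 (cell `bsd-f1-sign2`, SUPPLY lineage), file 45 of the series: sequel of `…ArchimedeanUnramifiedFrame`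
(§98–§99, Cor. 3.4 (i) with one REAL `T`-place from the FIVE-row finite menu, unconditional) and of gk2-p4 g12's `…ArchimedeanRowsHold`
(§73–§74: T-A / T-A′ / T-C / T-V by name for `d ≡ 1 (mod 8)`). THEOREMS ONLY (no definition, no named fact, no `sorry`, no local
instance); helper `--supports stmt-BirchSwinnertonDyer-22136`; no item is closed; BSD is not proved by any of this.

WHAT. The `-desc` packet `F1Sign2/DescentSignAtTwo.lean` has two rows left without a landing note: T-A⁵ (the shift law for the
UNRAMIFIED-at-`2` admissible parameters `F1Sign2.DescAdmissibleUnram W d`: `d < 0` squarefree, `d ≡ 5 (mod 8)`, `W` GOOD at `2`, primes of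
`d` good with `a_q` odd, `(d/ℓ) = 1` at odd bad `ℓ`; census 505/505) and T-A⁵′ (a split-admissible and an unramified-admissible twist of
the same curve have the same `#Sel₂`; 79/79). At `v = 2` such a `d` is NOT a `2`-adic square, so the three-row menu of files 21/25 has no
row; the five-row menu does (g11 §91: Lemma 2.10 (v) at `v ∣ 2` = Mazur's `E_N(ℚ₂) = E(ℚ₂)` for good reduction in the unramified
quadratic extension `ℚ₂(√d)`, `d ≡ 5 (mod 8)`):

* §100 `descAdmissibleUnram_place_menu₅` — a `DescAdmissibleUnram` parameter puts EVERY finite place of `ℚ` on the five-row menu: over `2`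
  the unramified-good row (`ι√d ∈ ℚ₂^{nr}` by file 36 `closureEmb_geomSqrt_mem_maxUnramified_of_emod_eight_eq_five`), over the primes of
  `d` the silent row, over the odd bad primes the split row, elsewhere good for both (file 25's dictionary otherwise verbatim);
* §101 `natCard_selmerGroup_twist_eq_mul_two_of_descAdmissibleUnram_of_strict` / `…_mul_two_eq_of_descAdmissibleUnram_of_exists` (UP /
  DOWN for a twist model), `twistSelmerTwoCard_eq_two_mul_of_strict_unram` / `two_mul_twistSelmerTwoCard_eq_of_exists_unram` (cell
  currency), **`unramifiedTwistSelmerShiftAtTwo_holds : UnramifiedTwistSelmerShiftAtTwo`** (T-A⁵), **`mixedTwistSelmerLevelAtTwo_holds :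
  MixedTwistSelmerLevelAtTwo`** (T-A⁵′), `twistSelmerTwoCard_eq_of_descAdmissibleUnram` (level law inside the unramified class) — NO
  hypothesis left (PT, Tate χ, Kramer's congruence for the framed identification, Mazur's norm theorem are tree theorems). The
  hypothesis `NoRationalTwoTorsion` of the typed rows is not used.

Honest framing: support-grade cell rows (Kramer 1981 Prop. 6 + Mazur 1972 / Kramer Prop. 3 at `2`) become unconditional kernel theorems;
beyond-print theorem: no; no item closed; crux 22136 stays OPEN at (U) ∧ (CONV₂); BSD is not proved by any of this.

References: [Kramer1981] §2 Props. 3, 6, Thm. 1; [Mazur1972] Cor. 4.4; [KramerTunnell1982] §6 Lemma 6.1; [MazurRubin2010] Thm. 2.7,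
Lemmas 2.9–2.10, Prop. 3.3, Cor. 3.4 (i); [Serre1973] II.3.3; [MilneADT2006] I Thm. 2.8, 2.13, 4.10.
-/

set_option linter.dupNamespace false -- tree convention: `Summit.BirchSwinnertonDyer.BirchSwinnertonDyer.Theorems` (summit = sub-problem)
set_option autoImplicit false

noncomputable section

open scoped Classical ContRepresentation

namespace Summit.BirchSwinnertonDyer.BirchSwinnertonDyer.Theorems.GenusKolyArch

open WeierstrassCurve Field NumberField IsDedekindDomain Function
open Literature.NumberTheory.EllipticCurves Literature.NumberTheory.GaloisRepresentations
open Literature.NumberTheory.GaloisRepresentations.IsNonarchimedeanLocalField (maxUnramified)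
open Literature.NumberTheory.GaloisCohomology
open Summit.BirchSwinnertonDyer.BirchSwinnertonDyer.Theorems.GenusKolyTwistLocal
open Summit.BirchSwinnertonDyer.Rank1Residual.F1Sign2
open Rat.HeightOneSpectrum (primesEquiv natGenerator)

/-! ## §100 An unramified-admissible `d` puts every finite place of `ℚ` on the five-row menu -/

section Menu

variable (W : WeierstrassCurve ℚ) [W.IsElliptic] [W.IsGloballyMinimal]

/-- **The five-row finite place menu for an unramified-at-`2` descent-admissible twist parameter.** `W/ℚ` globally minimal elliptic,
`d` with `F1Sign2.DescAdmissibleUnram W d` (`d < 0` squarefree, `d ≡ 5 (mod 8)`, `W` good at `2`, primes of `d` good with `a_q` odd,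
`(d/ℓ) = 1` at the odd bad primes), `Wd = C • W^{(d)}`, `φ, ψ` inverse intertwinings `Wd[2] ≅ W[2]`: every finite place `v` of `ℚ` is on
the five-row menu — over `2`: `W` good and `ι√d ∈ ℚ₂^{nr}` (`d ≡ 5 (mod 8)`, file 36); over a prime of `d`: odd and silent for both
curves (`a_q` odd); over an odd bad prime: split (`(d/ℓ) = 1` ⟹ `d ∈ ℚ_ℓ^{×2}`); elsewhere odd and good for both.
[cite: Serre1973, Ch. II §3.3 Thm 3] [cite: Kramer1981, Prop. 3] [cite: Mazur1972, Cor. 4.4] [cite: MazurRubin2010, Lemma 2.10] -/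
theorem descAdmissibleUnram_place_menu₅ {d : ℤ} (hd : DescAdmissibleUnram W d) {Wd : WeierstrassCurve ℚ} [Wd.IsElliptic]
    {C : VariableChange ℚ} (hC : C • W.quadraticTwist (d : ℚ) = Wd)
    (φ : (Wd.torsionGaloisModule ((2 : ℕ) : ℤ)).toContRepresentation →ⁱL
      (W.torsionGaloisModule ((2 : ℕ) : ℤ)).toContRepresentation)
    (ψ : (W.torsionGaloisModule ((2 : ℕ) : ℤ)).toContRepresentation →ⁱL
      (Wd.torsionGaloisModule ((2 : ℕ) : ℤ)).toContRepresentation)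
    (hψφ : ∀ a, ψ (φ a) = a) (hφψ : ∀ b, φ (ψ b) = b) :
    ∀ v : HeightOneSpectrum (𝓞 ℚ),
      (∃ s : v.adicCompletion ℚ, s ^ 2 = algebraMap ℚ (v.adicCompletion ℚ) (d : ℚ)) ∨
      (((2 : ℕ) : 𝓞 ℚ) ∉ v.asIdeal ∧
        ¬ 2 ∣ (W.baseChange (v.adicCompletion ℚ)).localTamagawaNumber (v.adicCompletionIntegers ℚ) ∧
        ¬ 2 ∣ (Wd.baseChange (v.adicCompletion ℚ)).localTamagawaNumber (v.adicCompletionIntegers ℚ)) ∨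
      (((2 : ℕ) : 𝓞 ℚ) ∉ v.asIdeal ∧ W.HasGoodReductionAt v ∧ Wd.HasGoodReductionAt v) ∨
      (((2 : ℕ) : 𝓞 ℚ) ∉ v.asIdeal ∧
        Nat.card (nsmulAddMonoidHom 2 : (W.baseChange (v.adicCompletion ℚ)).toAffine.Point →+ _).ker = 1 ∧
        Nat.card (nsmulAddMonoidHom 2 : (Wd.baseChange (v.adicCompletion ℚ)).toAffine.Point →+ _).ker = 1) ∨
      ((W.HasGoodReductionAt v ∨ (W.HasMultiplicativeReductionAt v ∧ Odd (W.ordMinimalDiscriminant v))) ∧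
        closureEmb (K := ℚ) (v.adicCompletion ℚ) (geomSqrt (d : ℚ)) ∈ maxUnramified (v.adicCompletion ℚ)) := by
  obtain ⟨-, -, hd8, hgood2, hprimes, hbad⟩ := hd
  intro v
  haveI := Fact.mk (primesEquiv v).2
  have hpP : (primesEquiv v : ℕ).Prime := (primesEquiv v).2
  have hpv : ((primesEquiv v : ℕ) : 𝓞 ℚ) ∈ v.asIdeal := Rat.HeightOneSpectrum.natCast_natGenerator_mem v
  -- a `p`-adic square gives the split option
  have hsplit : IsSquare ((d : ℤ) : ℚ_[(primesEquiv v : ℕ)]) →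
      ∃ s : v.adicCompletion ℚ, s ^ 2 = algebraMap ℚ (v.adicCompletion ℚ) (d : ℚ) := fun hsq ↦ by
    have hsq' : IsSquare (((d : ℚ) : ℚ) : ℚ_[(primesEquiv v : ℕ)]) := by
      simpa only [Rat.cast_intCast] using hsq
    obtain ⟨s, hs⟩ := TwoDescentLocal.isSquare_algebraMap_adicCompletion_of_padic v hsq'
    exact ⟨s, by rw [sq]; exact hs.symm⟩
  by_cases hp2 : (primesEquiv v : ℕ) = 2
  · -- over `2`: `W` good at `2` and `ι√d ∈ ℚ₂^{nr}` (`d ≡ 5 (mod 8)`) — the unramified-good row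
    have h2v : ((2 : ℕ) : 𝓞 ℚ) ∈ v.asIdeal := by rw [← hp2]; exact hpv
    have hW : W.HasGoodReductionAt v := by
      by_contra h
      have hdvd : (primesEquiv v : ℕ) ∣ W.conductorNorm ℤ := (W.dvd_conductorNorm_iff v).mpr h
      rw [hp2] at hdvd
      haveI : Fact (Nat.Prime 2) := ⟨Nat.prime_two⟩
      exact not_dvd_conductorNorm_of_hasGoodReductionAtPrime W (hgood2 inferInstance) hdvd
    exact Or.inr (Or.inr (Or.inr (Or.inr
      ⟨Or.inl hW, closureEmb_geomSqrt_mem_maxUnramified_of_emod_eight_eq_five v hp2 h2v hd8⟩)))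
  have h2v : ((2 : ℕ) : 𝓞 ℚ) ∉ v.asIdeal :=
    GenusKolyTwistingPrime.natCast_not_mem_of_not_dvd hpP hpv fun h ↦
      hp2 ((Nat.prime_dvd_prime_iff_eq hpP Nat.prime_two).mp h)
  by_cases hpd : ((primesEquiv v : ℕ) : ℤ) ∣ d
  · -- over a prime of `d`: odd, good, `a_p` odd ⟹ silent for `W`, hence for `Wd`
    obtain ⟨hgood, hodd⟩ := hprimes _ hpP hpd
    have hgood' : W.HasGoodReductionAtPrime (primesEquiv v : ℕ) := hgood inferInstance
    have hpΔ : ¬ ((primesEquiv v : ℕ) : ℤ) ∣ minimalDiscriminantInt W :=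
      W.not_dvd_minimalDiscriminantInt_of_hasGoodReductionAtPrime' _ hgood'
    have hsil := (GenusKolyTwin.silent_iff_odd_frobeniusTrace W hp2 hpΔ).mpr hodd
    have hker : Nat.card (nsmulAddMonoidHom 2 : (W.baseChange (v.adicCompletion ℚ)).toAffine.Point →+ _).ker = 1 := by
      rw [natCard_ker_nsmul_adicCompletion_eq_padic W v 2]
      have h0 := GenusKolyTwin.twoTorsion_padic_eq_zero_of_forall_ne W hp2 hpΔ hsil
      rw [Nat.card_eq_one_iff_unique]
      refine ⟨⟨fun a b ↦ Subtype.ext ((h0 a.1 a.2).trans (h0 b.1 b.2).symm)⟩, ⟨⟨0, by simp⟩⟩⟩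
    refine Or.inr (Or.inr (Or.inr (Or.inl ⟨h2v, hker, ?_⟩)))
    -- the `CharZero` / `Algebra` instances are passed explicitly so that the `ℚ`-algebra structure of `ℚ_v` stays the
    -- `adicCompletion` one (not `DivisionRing.toRatAlgebra`)
    rw [@natCard_ker_nsmul_eq_of_intertwining ℚ _ _ W Wd _ _ 2 two_ne_zero φ ψ hψφ hφψ (v.adicCompletion ℚ) _
      (HeightOneSpectrum.instAlgebraAdicCompletion (𝓞 ℚ) ℚ v) (charZero_adicCompletion v)]
    exact hker
  by_cases hpN : (primesEquiv v : ℕ) ∣ W.conductorNorm ℤ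
  · -- over an odd bad prime: `(d/p) = 1` makes `d` a `p`-adic square
    have hnotgood : ∀ _h : Fact (primesEquiv v : ℕ).Prime, ¬ W.HasGoodReductionAtPrime (primesEquiv v : ℕ) := fun _ hg ↦
      not_dvd_conductorNorm_of_hasGoodReductionAtPrime W hg hpN
    have hJ := hbad _ hpP hp2 hnotgood
    exact Or.inl (hsplit (padic_isSquare_of_jacobiSym_eq_one hp2 hJ))
  · -- over an odd good prime not dividing `d`: good for both
    have hW : W.HasGoodReductionAt v := by
      by_contra h
      exact hpN ((W.dvd_conductorNorm_iff v).mpr h)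
    have hp2d : ¬ (((primesEquiv v : Nat.Primes) : ℕ) : ℤ) ∣ 2 * d := by
      intro h
      rcases (Nat.prime_iff_prime_int.mp hpP).dvd_or_dvd h with h2' | hd'
      · exact hp2 ((Nat.prime_dvd_prime_iff_eq hpP Nat.prime_two).mp (by exact_mod_cast h2'))
      · exact hpd hd'
    exact Or.inr (Or.inr (Or.inl ⟨h2v, hW, hasGoodReductionAt_of_smul_quadraticTwist W v hp2d hW hC⟩))

end Menu

/-! ## §101 UP / DOWN for unramified-admissible twists over `ℚ`; T-A⁵ and T-A⁵′ by name -/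

section Rows

variable (W : WeierstrassCurve ℚ) [W.IsElliptic] [W.IsGloballyMinimal]

/-- **UP for an unramified-admissible twist when `Sel₂(W)` is strict at `∞` — UNCONDITIONAL.** `W/ℚ` globally minimal elliptic with
`Δ_W > 0`, `d` with `DescAdmissibleUnram W d`, `Wd = C • W^{(d)}`; if every class of `Sel₂(W)` localises to `0` at the real place then
`#Sel₂(Wd) = #Sel₂(W)·2`. §99's UP with §100's menu (the only `T`-place is `∞`: `d < 0`).
[cite: MazurRubin2010, Thm. 2.7, Lemmas 2.9–2.10, Cor. 3.4 (i)] [cite: Kramer1981, §2 Props. 3, 6, Thm. 1] [cite: Mazur1972, Cor. 4.4] -/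
theorem natCard_selmerGroup_twist_eq_mul_two_of_descAdmissibleUnram_of_strict (hΔ : 0 < W.Δ)
    {d : ℤ} (hd : DescAdmissibleUnram W d) {Wd : WeierstrassCurve ℚ} [Wd.IsElliptic] {C : VariableChange ℚ}
    (hC : C • W.quadraticTwist (d : ℚ) = Wd)
    (hstrict : ∀ c ∈ (W.kummerSelmerStructure ((2 : ℕ) : ℤ)).selmerGroup,
      galoisCohomology.localization (W.torsionGaloisModule ((2 : ℕ) : ℤ)) (Sum.inl Rat.infinitePlace) 1 c = 0) :
    Nat.card (Wd.selmerGroup 2) = Nat.card (W.selmerGroup 2) * 2 := by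
  have hdneg : d < 0 := hd.1
  have hd0' : ((d : ℤ) : ℚ) ≠ 0 := by exact_mod_cast hdneg.ne
  obtain ⟨φ, ψ, hψφ, hφψ, -⟩ := exists_intertwining_master_frame W Wd hd0' hC
  have hw₀ : (Rat.infinitePlace).IsReal := Rat.isReal_infinitePlace
  have hΔ' : 0 < InfinitePlace.embedding_of_isReal hw₀ W.Δ := by rwa [embedding_of_isReal_rat_apply, Rat.cast_pos]
  have hinf : ∀ w : InfinitePlace ℚ, w ≠ Rat.infinitePlace →
      (∃ s : w.Completion, s ^ 2 = algebraMap ℚ w.Completion ((d : ℤ) : ℚ)) ∨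
      ((∀ x : galoisCohomology (W.localGaloisModule w.Completion) 1, x = 0) ∧
        (∀ x : galoisCohomology (Wd.localGaloisModule w.Completion) 1, x = 0)) :=
    fun w hw ↦ absurd (Subsingleton.elim w _) hw
  have h := natCard_selmerGroup_twist_eq_mul_two_of_menu₅_inl W hd0' hC hw₀ hΔ'
    (forall_sq_ne_completion_of_neg (by exact_mod_cast hdneg) _)
    (descAdmissibleUnram_place_menu₅ W hd hC φ ψ hψφ hφψ) hinf hstrict
  simpa only [Nat.cast_ofNat] using h

/-- **DOWN for an unramified-admissible twist when some class of `Sel₂(W)` is non-trivial at `∞` — UNCONDITIONAL**: then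
`#Sel₂(Wd)·2 = #Sel₂(W)`. §99's DOWN with §100's menu.
[cite: MazurRubin2010, Lemmas 2.9–2.10, Prop. 3.3, Cor. 3.4 (i)] [cite: Kramer1981, §2 Props. 3, 6] [cite: Mazur1972, Cor. 4.4] -/
theorem natCard_selmerGroup_twist_mul_two_eq_of_descAdmissibleUnram_of_exists (hΔ : 0 < W.Δ)
    {d : ℤ} (hd : DescAdmissibleUnram W d) {Wd : WeierstrassCurve ℚ} [Wd.IsElliptic] {C : VariableChange ℚ}
    (hC : C • W.quadraticTwist (d : ℚ) = Wd)
    (hns : ∃ c ∈ (W.kummerSelmerStructure ((2 : ℕ) : ℤ)).selmerGroup,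
      galoisCohomology.localization (W.torsionGaloisModule ((2 : ℕ) : ℤ)) (Sum.inl Rat.infinitePlace) 1 c ≠ 0) :
    Nat.card (Wd.selmerGroup 2) * 2 = Nat.card (W.selmerGroup 2) := by
  have hdneg : d < 0 := hd.1
  have hd0' : ((d : ℤ) : ℚ) ≠ 0 := by exact_mod_cast hdneg.ne
  obtain ⟨φ, ψ, hψφ, hφψ, -⟩ := exists_intertwining_master_frame W Wd hd0' hC
  have hw₀ : (Rat.infinitePlace).IsReal := Rat.isReal_infinitePlace
  have hΔ' : 0 < InfinitePlace.embedding_of_isReal hw₀ W.Δ := by rwa [embedding_of_isReal_rat_apply, Rat.cast_pos]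
  have hinf : ∀ w : InfinitePlace ℚ, w ≠ Rat.infinitePlace →
      (∃ s : w.Completion, s ^ 2 = algebraMap ℚ w.Completion ((d : ℤ) : ℚ)) ∨
      ((∀ x : galoisCohomology (W.localGaloisModule w.Completion) 1, x = 0) ∧
        (∀ x : galoisCohomology (Wd.localGaloisModule w.Completion) 1, x = 0)) :=
    fun w hw ↦ absurd (Subsingleton.elim w _) hw
  have h := natCard_selmerGroup_twist_mul_two_eq_of_menu₅_inl W hd0' hC hw₀ hΔ'
    (forall_sq_ne_completion_of_neg (by exact_mod_cast hdneg) _)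
    (descAdmissibleUnram_place_menu₅ W hd hC φ ψ hψφ hφψ) hinf hns
  simpa only [Nat.cast_ofNat] using h

/-- **UP in the cell's currency, unconditional**: `Δ_W > 0`, `Sel₂(W)` strict at `∞` ⟹ `#Sel₂(W^{(d)}) = 2·#Sel₂(W)` for every
unramified-admissible `d`. [cite: MazurRubin2010, Thm. 2.7, Cor. 3.4 (i)] [cite: Kramer1981, §2 Props. 3, 6, Thm. 1] -/
theorem twistSelmerTwoCard_eq_two_mul_of_strict_unram (hΔ : 0 < W.Δ)
    (hstrict : ∀ c ∈ (W.kummerSelmerStructure ((2 : ℕ) : ℤ)).selmerGroup,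
      galoisCohomology.localization (W.torsionGaloisModule ((2 : ℕ) : ℤ)) (Sum.inl Rat.infinitePlace) 1 c = 0)
    {d : ℤ} (hd : DescAdmissibleUnram W d) :
    twistSelmerTwoCard W d = 2 * selmerTwoCard W := by
  have hd0 : d ≠ 0 := hd.1.ne
  haveI := W.isElliptic_quadraticTwist (show ((d : ℤ) : ℚ) ≠ 0 by exact_mod_cast hd0)
  have hC : (1 : VariableChange ℚ) • W.quadraticTwist ((d : ℤ) : ℚ) = W.quadraticTwist ((d : ℤ) : ℚ) := one_smul _ _
  have h := natCard_selmerGroup_twist_eq_mul_two_of_descAdmissibleUnram_of_strict W hΔ hd hC hstrict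
  rw [GenusKolyTwin.natCard_selmerGroup_model_eq_twistSelmerTwoCard W hd0 _ ⟨1, hC⟩] at h
  rw [h, selmerTwoCard, mul_comm]

/-- **DOWN in the cell's currency, unconditional**: `Δ_W > 0`, some class of `Sel₂(W)` non-trivial at `∞` ⟹
`2·#Sel₂(W^{(d)}) = #Sel₂(W)` for every unramified-admissible `d`. [cite: MazurRubin2010, Cor. 3.4 (i)] [cite: Kramer1981, §2 Props. 3, 6] -/
theorem two_mul_twistSelmerTwoCard_eq_of_exists_unram (hΔ : 0 < W.Δ)
    (hns : ∃ c ∈ (W.kummerSelmerStructure ((2 : ℕ) : ℤ)).selmerGroup,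
      galoisCohomology.localization (W.torsionGaloisModule ((2 : ℕ) : ℤ)) (Sum.inl Rat.infinitePlace) 1 c ≠ 0)
    {d : ℤ} (hd : DescAdmissibleUnram W d) :
    2 * twistSelmerTwoCard W d = selmerTwoCard W := by
  have hd0 : d ≠ 0 := hd.1.ne
  haveI := W.isElliptic_quadraticTwist (show ((d : ℤ) : ℚ) ≠ 0 by exact_mod_cast hd0)
  have hC : (1 : VariableChange ℚ) • W.quadraticTwist ((d : ℤ) : ℚ) = W.quadraticTwist ((d : ℤ) : ℚ) := one_smul _ _
  have h := natCard_selmerGroup_twist_mul_two_eq_of_descAdmissibleUnram_of_exists W hΔ hd hC hns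
  rw [GenusKolyTwin.natCard_selmerGroup_model_eq_twistSelmerTwoCard W hd0 _ ⟨1, hC⟩] at h
  rw [selmerTwoCard, ← h, mul_comm]

omit W in
/-- **T-A⁵ `F1Sign2.UnramifiedTwistSelmerShiftAtTwo` HOLDS** (Kramer 1981 Prop. 6 with Prop. 3 / Mazur's norm theorem at `2`;
Mazur–Rubin Cor. 3.4 (i) with `T = {∞}` and Lemma 2.10 (v) at `v = 2`; census 505/505): for every globally minimal elliptic `W/ℚ` with
`Δ_W > 0` (and `E(ℚ)[2] = 0`, unused) and every `d` with `DescAdmissibleUnram W d` (`d ≡ 5 (mod 8)`, `W` good at `2`), `#Sel₂(W^{(d)})` is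
`#Sel₂(W)/2` or `2·#Sel₂(W)` — DOWN iff some Selmer class is non-trivial at `∞`, UP iff `Sel₂(W)` is strict at `∞`. No hypothesis left.
[cite: Kramer1981, §2 Props. 3, 6, Thm. 1] [cite: Mazur1972, Cor. 4.4] [cite: MazurRubin2010, Thm. 2.7, Lemma 2.10 (v), Cor. 3.4 (i)] -/
theorem unramifiedTwistSelmerShiftAtTwo_holds : UnramifiedTwistSelmerShiftAtTwo := by
  intro W _ _ hΔ _ d hd
  by_cases hstrict : ∀ c ∈ (W.kummerSelmerStructure ((2 : ℕ) : ℤ)).selmerGroup,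
      galoisCohomology.localization (W.torsionGaloisModule ((2 : ℕ) : ℤ)) (Sum.inl Rat.infinitePlace) 1 c = 0
  · exact Or.inr (twistSelmerTwoCard_eq_two_mul_of_strict_unram W hΔ hstrict hd)
  · push Not at hstrict
    obtain ⟨c, hc, hne⟩ := hstrict
    exact Or.inl (two_mul_twistSelmerTwoCard_eq_of_exists_unram W hΔ ⟨c, hc, hne⟩ hd)

omit W in
/-- **T-A⁵′ `F1Sign2.MixedTwistSelmerLevelAtTwo` HOLDS** (level across the residue classes `d ≡ 1` / `d' ≡ 5 (mod 8)`; census 79/79): for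
every globally minimal elliptic `W/ℚ` with `Δ_W > 0`, every descent-admissible `d` and every unramified-admissible `d'`,
`#Sel₂(W^{(d)}) = #Sel₂(W^{(d')})` — both `2·#Sel₂(W)` if `Sel₂(W)` is strict at `∞` (gk2-p4 §73 for `d`, §101 for `d'`), both `#Sel₂(W)/2`
otherwise. Unconditional. [cite: Kramer1981, §2 Props. 3, 6] [cite: Mazur1972, Cor. 4.4] [cite: MazurRubin2010, Thm. 2.7, Cor. 3.4 (i)] -/
theorem mixedTwistSelmerLevelAtTwo_holds : MixedTwistSelmerLevelAtTwo := by
  intro W _ _ hΔ _ d d' hd hd'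
  by_cases hstrict : ∀ c ∈ (W.kummerSelmerStructure ((2 : ℕ) : ℤ)).selmerGroup,
      galoisCohomology.localization (W.torsionGaloisModule ((2 : ℕ) : ℤ)) (Sum.inl Rat.infinitePlace) 1 c = 0
  · rw [twistSelmerTwoCard_eq_two_mul_of_strict_frame W hΔ hstrict hd,
      twistSelmerTwoCard_eq_two_mul_of_strict_unram W hΔ hstrict hd']
  · push Not at hstrict
    obtain ⟨c, hc, hne⟩ := hstrict
    have h1 := two_mul_twistSelmerTwoCard_eq_of_exists_unconditional W hΔ ⟨c, hc, hne⟩ hd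
    have h2 := two_mul_twistSelmerTwoCard_eq_of_exists_unram W hΔ ⟨c, hc, hne⟩ hd'
    omega

/-- **The level law inside the unramified class** (`d`-independence of `#Sel₂(W^{(d)})` over the unramified-admissible parameters):
`#Sel₂(W^{(d)}) = #Sel₂(W^{(d')})` for all `d, d'` with `DescAdmissibleUnram W d`, `DescAdmissibleUnram W d'`, `Δ_W > 0`. Unconditional.
[cite: Kramer1981, §2 Props. 3, 6] [cite: MazurRubin2010, Thm. 2.7, Cor. 3.4 (i)] -/
theorem twistSelmerTwoCard_eq_of_descAdmissibleUnram (hΔ : 0 < W.Δ) {d d' : ℤ}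
    (hd : DescAdmissibleUnram W d) (hd' : DescAdmissibleUnram W d') :
    twistSelmerTwoCard W d = twistSelmerTwoCard W d' := by
  by_cases hstrict : ∀ c ∈ (W.kummerSelmerStructure ((2 : ℕ) : ℤ)).selmerGroup,
      galoisCohomology.localization (W.torsionGaloisModule ((2 : ℕ) : ℤ)) (Sum.inl Rat.infinitePlace) 1 c = 0
  · rw [twistSelmerTwoCard_eq_two_mul_of_strict_unram W hΔ hstrict hd,
      twistSelmerTwoCard_eq_two_mul_of_strict_unram W hΔ hstrict hd']
  · push Not at hstrict
    obtain ⟨c, hc, hne⟩ := hstrict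
    have h1 := two_mul_twistSelmerTwoCard_eq_of_exists_unram W hΔ ⟨c, hc, hne⟩ hd
    have h2 := two_mul_twistSelmerTwoCard_eq_of_exists_unram W hΔ ⟨c, hc, hne⟩ hd'
    omega

end Rows

end Summit.BirchSwinnertonDyer.BirchSwinnertonDyer.Theorems.GenusKolyArch

end
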